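/-
Copyright: harness tree, Literature layer (sorry-free). b2b-lace enum2-g12 (ENUMERATION SHARD B gen 12),
GAPS G8 (δ2)(i), SEEDCERT_U L4: the large-`u` bracket of `√(2πu) e^{-u} I_m(u)` (generic `m`, `J`, `s₀`).
-/
import Literature.Probability.LatticeModels.SRWHeatKernelHalfAngleBounds
import Literature.Probability.FitznerVanDerHofstad2017.InvSqrtOneSubBracket
import Mathlib.Algebra.Polynomial.Eval.Degree
import HarnessLib

/-!
# The large-`u` bracket of the continuous-time SRW kernel (`BesselBracket`, generic form)

For `u > 0`, `m : ℤ`, a truncation order `J : ℕ` and a cut point `0 < s₀ < 1` this file proves the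
two-sided (absolute-value) bracket

  `|√(2πu) q_u(m) - Σ_i g_i (2i-1)‼/(4u)ⁱ|`
  `  ≤ ρ_J (2J+1)‼/(4u)^{J+1} + √(2πu) e^{-2us₀²}`
  `    + √(2πu) (2/π) Σ_i |g_i| (2s₀)^{-1} ∫_{s₀²}^∞ tⁱ e^{-2ut} dt`                (`srwHeatKernel_bracket`)

where `q_u(m) = srwHeatKernel u m = e^{-u} I_m(u)`, `g_i` are the coefficients of the polynomial
`Pg(y) = T_m(1-2y) · B_J(y)` (`bracketPoly`; `B_J = Σ_{j≤J} β_j y^j` the Taylor polynomial of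
`(1-y)^{-1/2}`, `InvSqrtOneSubBracket`), and `ρ_J = β_{J+1}/(1-s₀²)`.  This is the real-analysis
lemma L4 of the Poisson-split seed certificate for the SRW integrals `I_{n,0}(x;d)` (every other
layer is exact rational arithmetic); the remaining conversion of `e^{-2us₀²}` into a power of `u`
for `u ≥ T ≥ (J+3/2)/(2s₀²)` is `SRWHeatKernelHalfAngleBounds.rpow_mul_exp_neg_mul_le_of_le`, and
the closed form of the incomplete Gamma integral is
`FitznerVanDerHofstad2017.SrwIntegralBesselUSplit`.

Proof: in the half-angle form `q_u(m) = (2/π)∫_{(0,1)} G`, `G = e^{-2us²} T_m(1-2s²)(1-s²)^{-1/2}`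
(`SRWHeatKernelHalfAngle`), split `(0,1) = (0,s₀] ∪ (s₀,1)` (CUT, `≤ e^{-2us₀²}` after `2/π`);
on `(0,s₀]` write `(1-s²)^{-1/2} = B_J(s²) + r(s²)` with `0 ≤ r(y) ≤ ρ_J y^{J+1}` (the bracket of
`InvSqrtOneSubBracket`), so `G = e^{-2us²} Pg(s²) + e^{-2us²} T_m(1-2s²) r(s²)`; the REMAINDER
integrates to at most `ρ_J ∫₀^∞ s^{2J+2} e^{-2us²} = ρ_J (2J+1)‼ √π/(2^{J+2}(2u)^{J+1}√(2u))`
(`|T_m| ≤ 1`, Gaussian moments), and `∫_{(0,s₀]} e^{-2us²}Pg(s²) = ∫₀^∞ - ∫_{s₀}^∞`: the MAIN TERM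
`(2/π)∫₀^∞ = (2πu)^{-1/2} Σ g_i (2i-1)‼/(4u)ⁱ` (`main_term_halfAngle`) and the COMPLETION error
`|∫_{s₀}^∞| ≤ Σ|g_i| (2s₀)^{-1}∫_{s₀²}^∞ tⁱe^{-2ut}dt`.

References: R. Fitzner, R. van der Hofstad, Electron. J. Probab. 22 (2017), §5.1.1 (5.2)–(5.5),
pp. 1089–1090 (large-argument evaluation of the Bessel representation of the SRW integrals).
[cite: FitznerVanDerHofstad2016NoBLE, §5.1.1 (5.2)-(5.5) p. 1089-1090]; T. Hara, G. Slade,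
Rev. Math. Phys. 4 (1992), Appendix B. [cite: HaraSlade1992b, Appendix B]
-/

noncomputable section

open Real MeasureTheory Set Finset Polynomial Polynomial.Chebyshev
open Literature.Probability.FitznerVanDerHofstad2017
open scoped Nat

namespace Literature.Probability.LatticeModels

/-! ## The polynomial `Pg = T_m(1-2y) B_J(y)` and the remainder `r = (1-y)^{-1/2} - B_J(y)` -/

/-- `B_J` as a polynomial: `Σ_{j≤J} β_j X^j`. [folklore] -/
def invSqrtPartialPoly (J : ℕ) : ℝ[X] :=
  ∑ j ∈ range (J + 1), Polynomial.C (invSqrtCoeff j) * Polynomial.X ^ j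

/-- `B_J` the polynomial evaluates to `B_J` the function. [folklore] -/
theorem eval_invSqrtPartialPoly (J : ℕ) (y : ℝ) :
    (invSqrtPartialPoly J).eval y = invSqrtPartial J y := by
  simp [invSqrtPartialPoly, invSqrtPartial, Polynomial.eval_finsetSum]

/-- `Pg(y) = T_m(1-2y) · B_J(y)` as a polynomial. [folklore] -/
def bracketPoly (m : ℤ) (J : ℕ) : ℝ[X] :=
  (T ℝ m).comp (Polynomial.C 1 - Polynomial.C 2 * Polynomial.X) * invSqrtPartialPoly J

/-- `Pg(y) = T_m(1-2y) B_J(y)`. [folklore] -/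
theorem eval_bracketPoly (m : ℤ) (J : ℕ) (y : ℝ) :
    (bracketPoly m J).eval y = (T ℝ m).eval (1 - 2 * y) * invSqrtPartial J y := by
  simp [bracketPoly, Polynomial.eval_comp, eval_invSqrtPartialPoly]

/-- The number of coefficients of `Pg` used (`natDegree + 1`). [folklore] -/
def bracketDeg (m : ℤ) (J : ℕ) : ℕ := (bracketPoly m J).natDegree + 1

/-- `g_i`, the `i`-th coefficient of `Pg`. [folklore] -/
def bracketCoeff (m : ℤ) (J : ℕ) (i : ℕ) : ℝ := (bracketPoly m J).coeff i

/-- `Pg(y) = Σ_{i < bracketDeg} g_i yⁱ`. [folklore] -/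
theorem eval_bracketPoly_eq_sum (m : ℤ) (J : ℕ) (y : ℝ) :
    (bracketPoly m J).eval y = ∑ i ∈ range (bracketDeg m J), bracketCoeff m J i * y ^ i :=
  Polynomial.eval_eq_sum_range y

/-- The remainder `r_J(y) = (1-y)^{-1/2} - B_J(y)`. [folklore] -/
def invSqrtRem (J : ℕ) (y : ℝ) : ℝ := (√(1 - y))⁻¹ - invSqrtPartial J y

/-- `0 ≤ r_J(y)` for `0 ≤ y < 1`. [folklore] -/
theorem invSqrtRem_nonneg (J : ℕ) {y : ℝ} (hy0 : 0 ≤ y) (hy1 : y < 1) : 0 ≤ invSqrtRem J y := by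
  have h := invSqrtPartial_le_inv_sqrt J hy0 hy1
  unfold invSqrtRem; linarith

/-- `r_J(y) ≤ β_{J+1} y^{J+1}/(1-σ)` for `0 ≤ y ≤ σ < 1`. [folklore] -/
theorem invSqrtRem_le (J : ℕ) {y σ : ℝ} (hy0 : 0 ≤ y) (hyσ : y ≤ σ) (hσ : σ < 1) :
    invSqrtRem J y ≤ invSqrtCoeff (J + 1) / (1 - σ) * y ^ (J + 1) := by
  have hy1 : y < 1 := lt_of_le_of_lt hyσ hσ
  have h := inv_sqrt_le_invSqrtPartial_add J hy0 hy1
  have hβ : 0 < invSqrtCoeff (J + 1) := invSqrtCoeff_pos _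
  have hnum : 0 ≤ invSqrtCoeff (J + 1) * y ^ (J + 1) := by positivity
  have h2 : invSqrtCoeff (J + 1) * y ^ (J + 1) / (1 - y)
      ≤ invSqrtCoeff (J + 1) * y ^ (J + 1) / (1 - σ) :=
    div_le_div_of_nonneg_left hnum (by linarith) (by linarith)
  unfold invSqrtRem
  calc (√(1 - y))⁻¹ - invSqrtPartial J y ≤ invSqrtCoeff (J + 1) * y ^ (J + 1) / (1 - y) := by linarith
    _ ≤ invSqrtCoeff (J + 1) * y ^ (J + 1) / (1 - σ) := h2
    _ = _ := by ring

/-! ## The pointwise decomposition and the three pieces -/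

/-- `G = e^{-2us²} Pg(s²) + e^{-2us²} T_m(1-2s²) r_J(s²)` (everywhere). [folklore] -/
theorem halfAngleIntegrand_eq_add (u : ℝ) (m : ℤ) (J : ℕ) (s : ℝ) :
    halfAngleIntegrand u m s
      = Real.exp (-(2 * u * s ^ 2)) * (bracketPoly m J).eval (s ^ 2)
        + Real.exp (-(2 * u * s ^ 2)) * (T ℝ m).eval (1 - 2 * s ^ 2) * invSqrtRem J (s ^ 2) := by
  rw [eval_bracketPoly, invSqrtRem, halfAngleIntegrand, div_eq_mul_inv]
  ring

/-- `e^{-2us²} Pg(s²) = Σ_i g_i (s^{2i} e^{-2us²})`. [folklore] -/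
theorem exp_mul_eval_bracketPoly_eq_sum (u : ℝ) (m : ℤ) (J : ℕ) (s : ℝ) :
    Real.exp (-(2 * u * s ^ 2)) * (bracketPoly m J).eval (s ^ 2)
      = ∑ i ∈ range (bracketDeg m J),
          bracketCoeff m J i * (s ^ (2 * i) * Real.exp (-(2 * u * s ^ 2))) := by
  rw [eval_bracketPoly_eq_sum, Finset.mul_sum]
  refine Finset.sum_congr rfl fun i _ => ?_
  rw [← pow_mul]
  ring

/-- `e^{-2us²} Pg(s²)` is integrable on `(0,∞)` (`u > 0`). [folklore] -/
theorem integrableOn_exp_mul_eval_bracketPoly {u : ℝ} (hu : 0 < u) (m : ℤ) (J : ℕ) :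
    IntegrableOn (fun s : ℝ => Real.exp (-(2 * u * s ^ 2)) * (bracketPoly m J).eval (s ^ 2))
      (Ioi 0) := by
  have hb : 0 < 2 * u := by positivity
  have h : IntegrableOn (fun s : ℝ => ∑ i ∈ range (bracketDeg m J),
      bracketCoeff m J i * (s ^ (2 * i) * Real.exp (-(2 * u * s ^ 2)))) (Ioi 0) :=
    integrable_finsetSum _ fun i _ => (integrableOn_pow_mul_exp_neg_mul_sq_Ioi i hb).const_mul _
  exact h.congr_fun (fun s _ => (exp_mul_eval_bracketPoly_eq_sum u m J s).symm) measurableSet_Ioi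

/-- **MAIN TERM**: `(2/π) ∫₀^∞ e^{-2us²} Pg(s²) ds = (2πu)^{-1/2} Σ_i g_i (2i-1)‼/(4u)ⁱ`.
[cite: FitznerVanDerHofstad2016NoBLE, §5.1.1 (5.2)-(5.5) p. 1089-1090] -/
theorem main_term_bracketPoly {u : ℝ} (hu : 0 < u) (m : ℤ) (J : ℕ) :
    2 / π * ∫ s in Ioi (0 : ℝ), Real.exp (-(2 * u * s ^ 2)) * (bracketPoly m J).eval (s ^ 2)
      = 1 / √(2 * π * u) * ∑ i ∈ range (bracketDeg m J),
          bracketCoeff m J i * ((2 * i - 1)‼ : ℝ) / (4 * u) ^ i := by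
  rw [← main_term_halfAngle hu (bracketCoeff m J) (bracketDeg m J)]
  congr 1
  refine setIntegral_congr_fun measurableSet_Ioi fun s _ => ?_
  rw [exp_mul_eval_bracketPoly_eq_sum, Finset.mul_sum]
  refine Finset.sum_congr rfl fun i _ => ?_
  ring

/-- **COMPLETION error**: for `u > 0`, `s₀ > 0`,
`|∫_{(s₀,∞)} e^{-2us²} Pg(s²) ds| ≤ Σ_i |g_i| (2s₀)^{-1} ∫_{(s₀²,∞)} tⁱ e^{-2ut} dt`.
[cite: FitznerVanDerHofstad2016NoBLE, §5.1.1 (5.2)-(5.5) p. 1089-1090] -/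
theorem abs_integral_exp_mul_eval_bracketPoly_Ioi_le {u s₀ : ℝ} (hu : 0 < u) (hs₀ : 0 < s₀)
    (m : ℤ) (J : ℕ) :
    |∫ s in Ioi s₀, Real.exp (-(2 * u * s ^ 2)) * (bracketPoly m J).eval (s ^ 2)|
      ≤ ∑ i ∈ range (bracketDeg m J), |bracketCoeff m J i|
          * (1 / (2 * s₀) * ∫ t in Ioi (s₀ ^ 2), t ^ i * Real.exp (-(2 * u * t))) := by
  have hb : 0 < 2 * u := by positivity
  have hsub : Ioi s₀ ⊆ Ioi (0 : ℝ) := Ioi_subset_Ioi hs₀.le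
  have hint : ∀ i ∈ range (bracketDeg m J), IntegrableOn
      (fun s : ℝ => bracketCoeff m J i * (s ^ (2 * i) * Real.exp (-(2 * u * s ^ 2)))) (Ioi s₀) :=
    fun i _ => ((integrableOn_pow_mul_exp_neg_mul_sq_Ioi i hb).mono_set hsub).const_mul _
  have hswap : ∫ s in Ioi s₀, Real.exp (-(2 * u * s ^ 2)) * (bracketPoly m J).eval (s ^ 2)
      = ∑ i ∈ range (bracketDeg m J), bracketCoeff m J i
          * ∫ s in Ioi s₀, s ^ (2 * i) * Real.exp (-(2 * u * s ^ 2)) := by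
    calc ∫ s in Ioi s₀, Real.exp (-(2 * u * s ^ 2)) * (bracketPoly m J).eval (s ^ 2)
        = ∫ s in Ioi s₀, ∑ i ∈ range (bracketDeg m J),
            bracketCoeff m J i * (s ^ (2 * i) * Real.exp (-(2 * u * s ^ 2))) :=
          setIntegral_congr_fun measurableSet_Ioi fun s _ => exp_mul_eval_bracketPoly_eq_sum u m J s
      _ = ∑ i ∈ range (bracketDeg m J),
            ∫ s in Ioi s₀, bracketCoeff m J i * (s ^ (2 * i) * Real.exp (-(2 * u * s ^ 2))) :=
          integral_finsetSum _ hint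
      _ = _ := Finset.sum_congr rfl fun i _ => integral_const_mul _ _
  rw [hswap]
  refine (Finset.abs_sum_le_sum_abs _ _).trans (Finset.sum_le_sum fun i _ => ?_)
  have hI0 : 0 ≤ ∫ s in Ioi s₀, s ^ (2 * i) * Real.exp (-(2 * u * s ^ 2)) :=
    setIntegral_nonneg measurableSet_Ioi fun s hs => by
      have : 0 < s := lt_trans hs₀ hs
      positivity
  rw [abs_mul, abs_of_nonneg hI0]
  exact mul_le_mul_of_nonneg_left (integral_pow_mul_exp_neg_mul_sq_Ioi_le i hb hs₀) (abs_nonneg _)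

/-- **REMAINDER**: for `u > 0`, `0 < s₀ < 1`,
`|∫_{(0,s₀]} e^{-2us²} T_m(1-2s²) r_J(s²) ds| ≤ ρ_J (2J+1)‼ √π / (2^{J+2} (2u)^{J+1} √(2u))`,
`ρ_J = β_{J+1}/(1-s₀²)`. [cite: FitznerVanDerHofstad2016NoBLE, §5.1.1 (5.2)-(5.5) p. 1089-1090] -/
theorem abs_integral_rem_le {u s₀ : ℝ} (hu : 0 < u) (hs₀0 : 0 < s₀) (hs₀1 : s₀ < 1) (m : ℤ) (J : ℕ) :
    |∫ s in Ioc 0 s₀, Real.exp (-(2 * u * s ^ 2)) * (T ℝ m).eval (1 - 2 * s ^ 2) * invSqrtRem J (s ^ 2)|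
      ≤ invSqrtCoeff (J + 1) / (1 - s₀ ^ 2)
          * (((2 * (J + 1) - 1)‼ : ℝ) * √π / (2 ^ (J + 1 + 1) * (2 * u) ^ (J + 1) * √(2 * u))) := by
  have hb : 0 < 2 * u := by positivity
  have hσ1 : s₀ ^ 2 < 1 := by nlinarith
  set ρ : ℝ := invSqrtCoeff (J + 1) / (1 - s₀ ^ 2) with hρ
  have hρ0 : 0 ≤ ρ := div_nonneg (invSqrtCoeff_pos _).le (by linarith)
  -- integrability of the remainder piece on `(0,s₀]`: it is `G - e^{-2us²}Pg(s²)` there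
  have hsub1 : Ioc (0 : ℝ) s₀ ⊆ Ioo 0 1 := fun s hs => ⟨hs.1, lt_of_le_of_lt hs.2 hs₀1⟩
  have hsub0 : Ioc (0 : ℝ) s₀ ⊆ Ioi 0 := fun s hs => hs.1
  have hIrem : IntegrableOn (fun s : ℝ => Real.exp (-(2 * u * s ^ 2)) * (T ℝ m).eval (1 - 2 * s ^ 2)
      * invSqrtRem J (s ^ 2)) (Ioc 0 s₀) := by
    have h := ((integrableOn_halfAngleIntegrand u m).mono_set hsub1).sub
      ((integrableOn_exp_mul_eval_bracketPoly hu m J).mono_set hsub0)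
    refine h.congr_fun (fun s _ => ?_) measurableSet_Ioc
    simp only [Pi.sub_apply]
    rw [halfAngleIntegrand_eq_add u m J s]
    ring
  -- pointwise bound
  have hpt : ∀ s ∈ Ioc (0 : ℝ) s₀, |Real.exp (-(2 * u * s ^ 2)) * (T ℝ m).eval (1 - 2 * s ^ 2)
      * invSqrtRem J (s ^ 2)| ≤ ρ * (s ^ (2 * (J + 1)) * Real.exp (-(2 * u * s ^ 2))) := by
    intro s hs
    have hs1 : s ≤ 1 := le_trans hs.2 hs₀1.le
    have hy0 : 0 ≤ s ^ 2 := sq_nonneg s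
    have hyσ : s ^ 2 ≤ s₀ ^ 2 := pow_le_pow_left₀ hs.1.le hs.2 2
    have hr0 : 0 ≤ invSqrtRem J (s ^ 2) := invSqrtRem_nonneg J hy0 (lt_of_le_of_lt hyσ hσ1)
    have hr1 : invSqrtRem J (s ^ 2) ≤ ρ * (s ^ 2) ^ (J + 1) := invSqrtRem_le J hy0 hyσ hσ1
    have hT : |(T ℝ m).eval (1 - 2 * s ^ 2)| ≤ 1 := abs_eval_T_one_sub_two_mul_sq_le_one m hs.1.le hs1
    rw [abs_mul, abs_mul, abs_of_pos (Real.exp_pos _), abs_of_nonneg hr0, ← pow_mul] at *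
    have hE : 0 ≤ Real.exp (-(2 * u * s ^ 2)) := (Real.exp_pos _).le
    calc Real.exp (-(2 * u * s ^ 2)) * |(T ℝ m).eval (1 - 2 * s ^ 2)| * invSqrtRem J (s ^ 2)
        ≤ Real.exp (-(2 * u * s ^ 2)) * 1 * (ρ * s ^ (2 * (J + 1))) := by gcongr
      _ = ρ * (s ^ (2 * (J + 1)) * Real.exp (-(2 * u * s ^ 2))) := by ring
  have hImom := integrableOn_pow_mul_exp_neg_mul_sq_Ioi (J + 1) hb
  calc |∫ s in Ioc 0 s₀, Real.exp (-(2 * u * s ^ 2)) * (T ℝ m).eval (1 - 2 * s ^ 2) * invSqrtRem J (s ^ 2)|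
      ≤ ∫ s in Ioc 0 s₀, |Real.exp (-(2 * u * s ^ 2)) * (T ℝ m).eval (1 - 2 * s ^ 2)
          * invSqrtRem J (s ^ 2)| := abs_integral_le_integral_abs
    _ ≤ ∫ s in Ioc 0 s₀, ρ * (s ^ (2 * (J + 1)) * Real.exp (-(2 * u * s ^ 2))) :=
        setIntegral_mono_on hIrem.abs ((hImom.mono_set hsub0).const_mul ρ) measurableSet_Ioc hpt
    _ ≤ ∫ s in Ioi 0, ρ * (s ^ (2 * (J + 1)) * Real.exp (-(2 * u * s ^ 2))) :=
        setIntegral_mono_set (hImom.const_mul ρ)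
          (ae_restrict_of_forall_mem measurableSet_Ioi fun s hs => by
            have : (0 : ℝ) < s := hs
            positivity)
          (Filter.Eventually.of_forall hsub0)
    _ = ρ * (((2 * (J + 1) - 1)‼ : ℝ) * √π / (2 ^ (J + 1 + 1) * (2 * u) ^ (J + 1) * √(2 * u))) := by
        rw [integral_const_mul, integral_pow_mul_exp_neg_mul_sq_Ioi (J + 1) hb]

/-- Normalisation of the remainder bound:
`√(2πu) (2/π) · ρ (2J+1)‼ √π/(2^{J+2}(2u)^{J+1}√(2u)) = ρ (2J+1)‼/(4u)^{J+1}`. [folklore] -/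
theorem rem_bound_normalisation {u : ℝ} (hu : 0 < u) (ρ : ℝ) (J : ℕ) :
    √(2 * π * u) * (2 / π)
        * (ρ * (((2 * (J + 1) - 1)‼ : ℝ) * √π / (2 ^ (J + 1 + 1) * (2 * u) ^ (J + 1) * √(2 * u))))
      = ρ * ((2 * J + 1)‼ : ℝ) / (4 * u) ^ (J + 1) := by
  have hπ : 0 < π := Real.pi_pos
  have hb : 0 < 2 * u := by positivity
  have hsu : √(2 * π * u) = √π * √(2 * u) := by
    rw [show 2 * π * u = π * (2 * u) by ring, Real.sqrt_mul Real.pi_pos.le]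
  have hsπ : √π ≠ 0 := (Real.sqrt_pos.2 hπ).ne'
  have hs2 : √(2 * u) ≠ 0 := (Real.sqrt_pos.2 hb).ne'
  have hJ : 2 * (J + 1) - 1 = 2 * J + 1 := by omega
  rw [hsu, hJ, show (4 * u) ^ (J + 1) = 2 ^ (J + 1) * (2 * u) ^ (J + 1) by rw [← mul_pow]; ring]
  field_simp
  rw [Real.sq_sqrt hπ.le]
  ring

/-! ## The bracket -/

/-- **The large-`u` bracket of `√(2πu) q_u(m)`** (SEEDCERT_U L4 before the conversion of
`e^{-2us₀²}` into a power of `u`): for `u > 0`, `m : ℤ`, `J : ℕ`, `0 < s₀ < 1`,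
`|√(2πu) q_u(m) - Σ_i g_i (2i-1)‼/(4u)ⁱ| ≤ ρ_J (2J+1)‼/(4u)^{J+1} + √(2πu) e^{-2us₀²}`
`  + √(2πu)(2/π) Σ_i |g_i| (2s₀)^{-1} ∫_{(s₀²,∞)} tⁱ e^{-2ut} dt`,
with `g_i = bracketCoeff m J i` the coefficients of `T_m(1-2y) B_J(y)` and
`ρ_J = β_{J+1}/(1-s₀²)`. [cite: FitznerVanDerHofstad2016NoBLE, §5.1.1 (5.2)-(5.5) p. 1089-1090] -/
theorem srwHeatKernel_bracket {u s₀ : ℝ} (hu : 0 < u) (hs₀0 : 0 < s₀) (hs₀1 : s₀ < 1) (m : ℤ) (J : ℕ) :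
    |√(2 * π * u) * srwHeatKernel u m
        - ∑ i ∈ range (bracketDeg m J), bracketCoeff m J i * ((2 * i - 1)‼ : ℝ) / (4 * u) ^ i|
      ≤ invSqrtCoeff (J + 1) / (1 - s₀ ^ 2) * ((2 * J + 1)‼ : ℝ) / (4 * u) ^ (J + 1)
        + √(2 * π * u) * Real.exp (-(2 * u * s₀ ^ 2))
        + √(2 * π * u) * (2 / π) * ∑ i ∈ range (bracketDeg m J), |bracketCoeff m J i|
            * (1 / (2 * s₀) * ∫ t in Ioi (s₀ ^ 2), t ^ i * Real.exp (-(2 * u * t))) := by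
  -- names for the pieces
  set G : ℝ → ℝ := halfAngleIntegrand u m with hGdef
  set P : ℝ → ℝ := fun s => Real.exp (-(2 * u * s ^ 2)) * (bracketPoly m J).eval (s ^ 2) with hPdef
  set Rm : ℝ → ℝ := fun s => Real.exp (-(2 * u * s ^ 2)) * (T ℝ m).eval (1 - 2 * s ^ 2)
    * invSqrtRem J (s ^ 2) with hRmdef
  set Main : ℝ := ∑ i ∈ range (bracketDeg m J),
    bracketCoeff m J i * ((2 * i - 1)‼ : ℝ) / (4 * u) ^ i with hMain
  have hπ : 0 < π := Real.pi_pos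
  have hK : 0 < √(2 * π * u) := Real.sqrt_pos.2 (by positivity)
  -- integrability
  have hsub1 : Ioc (0 : ℝ) s₀ ⊆ Ioo 0 1 := fun s hs => ⟨hs.1, lt_of_le_of_lt hs.2 hs₀1⟩
  have hsub2 : Ioo s₀ 1 ⊆ Ioo (0 : ℝ) 1 := fun s hs => ⟨lt_trans hs₀0 hs.1, hs.2⟩
  have hsub0 : Ioc (0 : ℝ) s₀ ⊆ Ioi 0 := fun s hs => hs.1
  have hsub3 : Ioi s₀ ⊆ Ioi (0 : ℝ) := Ioi_subset_Ioi hs₀0.le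
  have iG : IntegrableOn G (Ioo 0 1) := integrableOn_halfAngleIntegrand u m
  have iP : IntegrableOn P (Ioi 0) := integrableOn_exp_mul_eval_bracketPoly hu m J
  have iRm : IntegrableOn Rm (Ioc 0 s₀) := by
    have h := (iG.mono_set hsub1).sub (iP.mono_set hsub0)
    refine h.congr_fun (fun s _ => ?_) measurableSet_Ioc
    simp only [Pi.sub_apply, hGdef, hPdef, hRmdef]
    rw [halfAngleIntegrand_eq_add u m J s]
    ring
  -- the splitting identities
  have h1 : ∫ s in Ioo 0 1, G s = (∫ s in Ioc 0 s₀, G s) + ∫ s in Ioo s₀ 1, G s := by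
    rw [← Ioc_union_Ioo_eq_Ioo hs₀0.le hs₀1]
    exact setIntegral_union (Set.disjoint_left.2 fun s hs hs' => (not_lt.2 hs.2) hs'.1)
      measurableSet_Ioo (iG.mono_set hsub1) (iG.mono_set hsub2)
  have h2 : ∫ s in Ioc 0 s₀, G s = (∫ s in Ioc 0 s₀, P s) + ∫ s in Ioc 0 s₀, Rm s := by
    rw [← integral_add (iP.mono_set hsub0) iRm]
    exact setIntegral_congr_fun measurableSet_Ioc fun s _ => halfAngleIntegrand_eq_add u m J s
  have h3 : ∫ s in Ioc 0 s₀, P s = (∫ s in Ioi 0, P s) - ∫ s in Ioi s₀, P s := by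
    have h : ∫ s in Ioi 0, P s = (∫ s in Ioc 0 s₀, P s) + ∫ s in Ioi s₀, P s := by
      rw [← Ioc_union_Ioi_eq_Ioi hs₀0.le]
      exact setIntegral_union (Set.disjoint_left.2 fun s hs hs' => (not_lt.2 hs.2) hs')
        measurableSet_Ioi (iP.mono_set hsub0) (iP.mono_set hsub3)
    linarith
  have hM : √(2 * π * u) * (2 / π * ∫ s in Ioi 0, P s) = Main := by
    rw [hPdef, main_term_bracketPoly hu m J, ← hMain]
    field_simp
  have hF : srwHeatKernel u m = 2 / π * ∫ s in Ioo 0 1, G s :=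
    srwHeatKernel_eq_integral_halfAngle u m
  -- the key identity
  have hkey : √(2 * π * u) * srwHeatKernel u m - Main
      = √(2 * π * u) * (2 / π)
          * (-(∫ s in Ioi s₀, P s) + (∫ s in Ioc 0 s₀, Rm s) + ∫ s in Ioo s₀ 1, G s) := by
    rw [hF, h1, h2, h3]
    linear_combination hM
  -- the three bounds
  have hX : 2 / π * |∫ s in Ioo s₀ 1, G s| ≤ Real.exp (-(2 * u * s₀ ^ 2)) :=
    abs_integral_halfAngleIntegrand_cut_le hu.le m hs₀0.le
  have hA := abs_integral_exp_mul_eval_bracketPoly_Ioi_le hu hs₀0 m J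
  have hB : √(2 * π * u) * (2 / π) * |∫ s in Ioc 0 s₀, Rm s|
      ≤ invSqrtCoeff (J + 1) / (1 - s₀ ^ 2) * ((2 * J + 1)‼ : ℝ) / (4 * u) ^ (J + 1) := by
    have h := mul_le_mul_of_nonneg_left (abs_integral_rem_le hu hs₀0 hs₀1 m J)
      (by positivity : 0 ≤ √(2 * π * u) * (2 / π))
    rw [rem_bound_normalisation hu _ J] at h
    simpa [mul_div_assoc] using h
  -- assemble
  rw [hkey, abs_mul, abs_of_pos (by positivity : 0 < √(2 * π * u) * (2 / π))]
  have htri : |-(∫ s in Ioi s₀, P s) + (∫ s in Ioc 0 s₀, Rm s) + ∫ s in Ioo s₀ 1, G s|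
      ≤ |∫ s in Ioi s₀, P s| + |∫ s in Ioc 0 s₀, Rm s| + |∫ s in Ioo s₀ 1, G s| := by
    have e1 := abs_add_le (-(∫ s in Ioi s₀, P s) + ∫ s in Ioc 0 s₀, Rm s) (∫ s in Ioo s₀ 1, G s)
    have e2 := abs_add_le (-(∫ s in Ioi s₀, P s)) (∫ s in Ioc 0 s₀, Rm s)
    rw [abs_neg] at e2
    linarith
  have hKA := mul_le_mul_of_nonneg_left hA (by positivity : 0 ≤ √(2 * π * u) * (2 / π))
  have hKX : √(2 * π * u) * (2 / π) * |∫ s in Ioo s₀ 1, G s|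
      ≤ √(2 * π * u) * Real.exp (-(2 * u * s₀ ^ 2)) := by
    have := mul_le_mul_of_nonneg_left hX hK.le
    linarith [this]
  calc √(2 * π * u) * (2 / π)
        * |-(∫ s in Ioi s₀, P s) + (∫ s in Ioc 0 s₀, Rm s) + ∫ s in Ioo s₀ 1, G s|
      ≤ √(2 * π * u) * (2 / π)
        * (|∫ s in Ioi s₀, P s| + |∫ s in Ioc 0 s₀, Rm s| + |∫ s in Ioo s₀ 1, G s|) := by gcongr
    _ = √(2 * π * u) * (2 / π) * |∫ s in Ioi s₀, P s|
        + √(2 * π * u) * (2 / π) * |∫ s in Ioc 0 s₀, Rm s|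
        + √(2 * π * u) * (2 / π) * |∫ s in Ioo s₀ 1, G s| := by ring
    _ ≤ _ := by linarith [hKA, hB, hKX]

end Literature.Probability.LatticeModels
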